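import Summits.BirchSwinnertonDyer.Rank1Residual.O5.FlexNFIsogenousCaseSKodairaLawThreeCells
import Summits.BirchSwinnertonDyer.Rank1Residual.O5.FlexNFCaseNKodairaValLawThreeProofs
import Summits.BirchSwinnertonDyer.Rank1Residual.O5.FlexNFCaseNTailThree
import HarnessLib

/-!
# T31 Case N of the flex normal form at `3` — the isogenous column `E′ = isoQ b A₃ 0` on the cells `w = v₃(b³ − A₃) ∈ {1, 2, 3}`:
# `w = 1` (`b ≡ 1`, `A₃ ≢ 1 (mod 9)`) ⟹ `II*`, `v₃Δ_min = 12` (minimal BY THE EXIT); `w = 2` ⟹ `II`, `3`; `w = 3` ⟹ `I₀*`, `6`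
# (on the `u = 3` rescaled model) — Tate's algorithm in the kernel
# (cell `b2b-bsdres`, team n1011, ROW T-FLEX-KOD FILE 4a / RESEAT-TRIGGER T5; seat `b2b-bsdres-n1011-p18` GEN 13 (bank) /
#  GEN 14 (filing); theorems only; the `w ≥ 4` tail is the tree's `FlexNFCaseNTailThree`, the `w = 0` cells are FILE 4b)

HONEST FRAMING (cell `b2b-bsdres`, run/shared/lean/b2b/bsd-rank1-residual/, verbatim in every file): the
goal of the cell is to DELETE the COMBINATION-SHAPED residual classes of the Birch–Swinnerton-Dyer formula
for ALL analytic-rank `≤ 1` elliptic curves over `ℚ` — "full BSD formula for every rank `≤ 1` curve in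
class `C`" assembled STRICTLY from published theorems — so that the rank-`≤ 1` remainder becomes exactly
the CONSTRUCTION-SHAPED classes, which are TYPED (missing-input `Prop`s), NOT attempted. This is not
"finishing BSD". Lane CLASS-CLOSURE / O5 (O5 OPEN): research route; census output (P-K20) is EVIDENCE,
never a Literature fact; nothing is booked; no mark of `RESIDUAL-MAP.md` moves. This file: THEOREMS ONLY
(no definition, no named fact, no `@[conjecture]` node, no `sorry`; net named-fact debt `0`); nothing of
cc-typer-5's / o5-r1's files is edited; a `_holds` theorem for a conjecture node closes NO pair and moves NO mark.
[cite: SilvermanATAEC1994, IV.9.4 (Tate's algorithm)]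
-/

open scoped NumberField

open IsDedekindDomain Rat.HeightOneSpectrum WeierstrassCurve NumberField
  Literature.NumberTheory.EllipticCurves Literature.NumberTheory.EllipticCurves.Rank1Residual
  Literature.NumberTheory.DiophantineGeometry Literature.NumberTheory.DiophantineGeometry.TateAlgorithm
  Summit.BirchSwinnertonDyer.BirchSwinnertonDyer.Rank2Observatory.Tate
  Summit.BirchSwinnertonDyer.BirchSwinnertonDyer.Rank2Observatory.RootNumber
  Summit.BirchSwinnertonDyer.Rank1Residual Summit.BirchSwinnertonDyer.Rank1Residual.Additive

namespace Summit.BirchSwinnertonDyer.Rank1Residual.O5.FlexNormalForm.Isogenous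

/-! The tail `kodairaSymbolAt_and_ord_isoQ_zero_tail` is in `O5/FlexNFCaseNTailThree.lean` (F3⁻). -/

/-- **T31-N, `w = 2` and `w = 3` on the rescaled model** (`b ≡ A₃ ≡ 1 (mod 3)`): with `b³ − A₃ = 9M₁` (`3 ∤ M₁`)
the rescaled integer model `[0, −3b², 0, 24bM₁, −48M₁²]` is Step-2 normalised with `3 ∥ a₆` ⇒ `II`, `v₃Δ_min = 3`;
with `b³ − A₃ = 27M₁` the model `[0, −3b², 0, 72bM₁, −432M₁²]` is Step-6 normalised and its cubic
`T³ − b²T² + 8bM₁T − 16M₁²` has discriminant `≢ 0 (mod 3)` ⇒ `I₀*`, `v₃Δ_min = 6`.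
[cite: SilvermanATAEC1994, IV.9.4 Steps 1–6] [cite: SilvermanAEC2009, VII.1 Remark 1.1] -/
theorem kodairaSymbolAt_and_ord_isoQ_zero_mid (b A₃ : ℤ) (hA : A₃ % 3 = 1) (hb : b % 3 = 1) {w : ℕ}
    (hw : w = 2 ∨ w = 3) (hM : (3 : ℤ) ^ w ∣ b ^ 3 - A₃) (hM' : ¬ (3 : ℤ) ^ (w + 1) ∣ b ^ 3 - A₃) :
    (isoQ b A₃ 0).kodairaSymbolAt (Additive.placeOf 3) = (if w = 2 then .II else .Istar 0) ∧
      (isoQ b A₃ 0).ordMinimalDiscriminant (Additive.placeOf 3) = 3 * w - 3 := by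
  haveI : Fact (Nat.Prime 3) := ⟨Nat.prime_three⟩
  have hA3 : ¬ (3 : ℤ) ∣ A₃ := by
    intro h; have := (Int.dvd_iff_emod_eq_zero ..).mp h; omega
  have hb3 : ¬ (3 : ℤ) ∣ b := by
    intro h; have := (Int.dvd_iff_emod_eq_zero ..).mp h; omega
  have hA0 : A₃ ≠ 0 := by rintro rfl; exact hA3 (dvd_zero _)
  obtain ⟨M₁, hM₁⟩ := hM
  have hM₁u : ¬ (3 : ℤ) ∣ M₁ := fun ⟨k, hk⟩ ↦ hM' ⟨k, by rw [hM₁, hk, pow_succ]; ring⟩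
  have hM₁0 : M₁ ≠ 0 := by rintro rfl; exact hM₁u (dvd_zero _)
  obtain ⟨w', rfl⟩ : ∃ w', w = w' + 2 := ⟨w - 2, by omega⟩
  have hw' : w' = 0 ∨ w' = 1 := by omega
  have hA₃ : A₃ = b ^ 3 - 3 ^ (w' + 2) * M₁ := by linear_combination -hM₁
  subst hA₃
  set R₀ : WeierstrassCurve ℤ :=
    ⟨0, -(3 * b ^ 2), 0, 8 * b * 3 ^ (w' + 1) * M₁, -(16 * 3 ^ (2 * w' + 1) * M₁ ^ 2)⟩ with hR₀
  haveI hell : (isoQ b (b ^ 3 - 3 ^ (w' + 2) * M₁) 0).IsElliptic := by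
    refine ⟨(show (isoQ b (b ^ 3 - 3 ^ (w' + 2) * M₁) 0).Δ ≠ 0 from ?_).isUnit⟩
    rw [isoQ, isoModel_Δ]
    push_cast
    have : (M₁ : ℚ) ≠ 0 := by exact_mod_cast hM₁0
    have : ((b : ℚ) ^ 3 - 3 ^ (w' + 2) * (M₁ : ℚ)) ≠ 0 := by exact_mod_cast hA0
    have e : ((b : ℚ) ^ 3 - ((b : ℚ) ^ 3 - 3 ^ 0 * ((b : ℚ) ^ 3 - 3 ^ (w' + 2) * (M₁ : ℚ)))) =
        ((b : ℚ) ^ 3 - 3 ^ (w' + 2) * (M₁ : ℚ)) := by ring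
    have e' : ((b : ℚ) ^ 3 - 3 ^ 0 * ((b : ℚ) ^ 3 - 3 ^ (w' + 2) * (M₁ : ℚ))) = 3 ^ (w' + 2) * (M₁ : ℚ) := by ring
    rw [e, e']
    positivity
  have hrel : (⟨Units.mk0 (3 : ℚ) (by norm_num), 0, 0, 0⟩ : VariableChange ℚ) •
      isoQ b (b ^ 3 - 3 ^ (w' + 2) * M₁) 0 = R₀.baseChange ℚ := by
    ext <;> simp [variableChange_a₁, variableChange_a₂, variableChange_a₃, variableChange_a₄,
      variableChange_a₆, isoQ, isoModel, hR₀, WeierstrassCurve.baseChange, WeierstrassCurve.map] <;>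
      ring
  have eΔ : R₀.Δ = 3 ^ (3 * w' + 3) * (2 ^ 12 * ((b ^ 3 - 3 ^ (w' + 2) * M₁) * M₁ ^ 3)) := by
    simp only [hR₀, WeierstrassCurve.Δ, WeierstrassCurve.b₂, WeierstrassCurve.b₄, WeierstrassCurve.b₆,
      WeierstrassCurve.b₈]
    ring
  have hΔ : (3 : ℤ) ^ (3 * w' + 3) ∣ R₀.Δ := by rw [eΔ]; exact dvd_mul_right _ _
  have hΔ' : ¬ (3 : ℤ) ^ (3 * w' + 3 + 1) ∣ R₀.Δ := by
    rw [eΔ]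
    refine not_pow_succ_dvd_pow_mul' _ (not_three_dvd_mul not_three_dvd_two_pow
      (not_three_dvd_mul hA3 (not_three_dvd_pow hM₁u 3)))
  have e2 : R₀.a₂ = -(3 * b ^ 2) := rfl
  have e3 : R₀.a₃ = 0 := rfl
  have e4 : R₀.a₄ = 8 * b * 3 ^ (w' + 1) * M₁ := rfl
  have e6 : R₀.a₆ = -(16 * 3 ^ (2 * w' + 1) * M₁ ^ 2) := rfl
  have eb₂ : R₀.b₂ = 3 * (-(4 * b ^ 2)) := by simp [hR₀, WeierstrassCurve.b₂]; ring
  have hR : (R₀.baseChange ℚ).kodairaSymbolAt (Additive.placeOf 3) = (if w' + 2 = 2 then .II else .Istar 0) ∧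
      (R₀.baseChange ℚ).ordMinimalDiscriminant (Additive.placeOf 3) = 3 * w' + 3 := by
    refine FlexNormalForm.kodairaSymbolAt_and_ordMinimalDiscriminant_placeOf_three_of_intModel R₀ R₀ 1 rfl
      (one_smul _ _).symm
      (fun v' hv' ↦ isMinimalAt_of_criterion v' hv' R₀ hΔ hΔ' (Or.inl (by omega))) hΔ hΔ' ?_
    intro v' ε hε hpε
    haveI := perfectField_residueField_adicCompletionIntegers (K := ℚ) v'
    rcases hw' with rfl | rfl
    · -- `w = 2`: type II (Step 3, `3 ∥ a₆ = −48M₁²`)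
      rw [if_pos rfl]
      obtain ⟨f1, f2, f3, f4, f6, fΔ⟩ := map_intCast_eqs (R := v'.adicCompletionIntegers ℚ) R₀
      refine kodairaSymbolOfMinimal_eq_II_of_step2 ?_ ?_ ?_ ?_ ?_ ?_
      · rw [fΔ]; exact uniformizer_dvd_intCast hpε ((pow_dvd_pow (3 : ℤ) (by norm_num : 1 ≤ 3 * 0 + 3)).trans hΔ)
      · rw [f3, e3]; simp
      · rw [f4, e4]; exact uniformizer_dvd_intCast hpε ⟨8 * b * M₁, by push_cast; ring⟩
      · rw [f6, e6]; exact uniformizer_dvd_intCast hpε ⟨-(16 * M₁ ^ 2), by push_cast; ring⟩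
      · rw [WeierstrassCurve.map_b₂, eb₂, eq_intCast]
        exact uniformizer_dvd_intCast hpε (by rw [pow_one]; exact dvd_mul_right _ _)
      · rw [f6, e6]
        refine not_pow_succ_dvd_intCast Nat.prime_three hε hpε (n := 1) ⟨-(16 * M₁ ^ 2), by push_cast; ring⟩ ?_
        rw [show -(16 * (3 : ℤ) ^ (2 * 0 + 1) * M₁ ^ 2) = 3 ^ 1 * (-(16 * M₁ ^ 2)) by ring]
        refine not_natCast_pow_dvd (not_pow_succ_dvd_pow_mul' 1 ?_)
        rw [dvd_neg]; exact not_three_dvd_mul (by decide) (not_three_dvd_pow hM₁u 2)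
    · -- `w = 3`: type I₀* (Step 6, cubic discriminant `≢ 0`)
      rw [if_neg (by norm_num)]
      refine kodairaSymbolOfMinimal_intCast_eq_Istar_zero Nat.prime_three hε hpε ?_ ?_ ?_ ?_ ?_ ?_
      · simp [hR₀]
      · rw [e2]; exact ⟨-(b ^ 2), by push_cast; ring⟩
      · rw [e3]; simp
      · rw [e4]; exact ⟨8 * b * M₁, by push_cast; ring⟩
      · rw [e6]; exact ⟨-(16 * M₁ ^ 2), by push_cast; ring⟩
      · rw [e2, e4, e6]
        have d2 : -(3 * b ^ 2) / ((3 : ℕ) : ℤ) ^ 1 = -(b ^ 2) := by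
          rw [show -(3 * b ^ 2) = (3 : ℤ) ^ 1 * (-(b ^ 2)) by ring]; push_cast
          rw [Int.mul_ediv_cancel_left _ (by norm_num)]
        have d4 : 8 * b * (3 : ℤ) ^ (1 + 1) * M₁ / ((3 : ℕ) : ℤ) ^ 2 = 8 * b * M₁ := by
          rw [show 8 * b * (3 : ℤ) ^ (1 + 1) * M₁ = 3 ^ 2 * (8 * b * M₁) by ring]; push_cast
          rw [Int.mul_ediv_cancel_left _ (by norm_num)]
        have d6 : -(16 * (3 : ℤ) ^ (2 * 1 + 1) * M₁ ^ 2) / ((3 : ℕ) : ℤ) ^ 3 = -(16 * M₁ ^ 2) := by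
          rw [show -(16 * (3 : ℤ) ^ (2 * 1 + 1) * M₁ ^ 2) = 3 ^ 3 * (-(16 * M₁ ^ 2)) by ring]; push_cast
          rw [Int.mul_ediv_cancel_left _ (by norm_num)]
        rw [d2, d4, d6, pow_one]
        -- `disc ≡ q² + q³ − 1` with `q = bM₁`; `q ≡ ±1 (mod 3)` gives `1` or `2`
        obtain ⟨m, hm⟩ := three_dvd_sq_sub_one hb3
        obtain ⟨m', hm'⟩ := three_dvd_sq_sub_one hM₁u
        intro h
        have e : disc3 (-(b ^ 2)) (8 * b * M₁) (-(16 * M₁ ^ 2)) =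
            64 * b ^ 6 * M₁ ^ 2 - 2048 * b ^ 3 * M₁ ^ 3 - 64 * b ^ 6 * M₁ ^ 2 - 6912 * M₁ ^ 4
              + 2304 * b ^ 3 * M₁ ^ 3 := by rw [disc3]; ring
        rw [e] at h
        -- = 256 b³M₁³ − 6912 M₁⁴ = 256 M₁³ (b³ − 27 M₁) ≡ M₁³ b³ (mod 3): a unit
        have h' : (3 : ℤ) ∣ 256 * (b ^ 3 * M₁ ^ 3) := by
          have : (64 : ℤ) * b ^ 6 * M₁ ^ 2 - 2048 * b ^ 3 * M₁ ^ 3 - 64 * b ^ 6 * M₁ ^ 2 - 6912 * M₁ ^ 4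
              + 2304 * b ^ 3 * M₁ ^ 3 = 3 * (-(2304 * M₁ ^ 4)) + 256 * (b ^ 3 * M₁ ^ 3) := by ring
          rw [this] at h
          exact (Int.dvd_add_right (dvd_mul_right 3 _)).mp (by exact_mod_cast h)
        rcases Int.prime_three.dvd_or_dvd h' with h'' | h''
        · exact absurd h'' (by decide)
        · exact not_three_dvd_mul (not_three_dvd_pow hb3 3) (not_three_dvd_pow hM₁u 3) h''
  obtain ⟨hK, hO⟩ := kodairaSymbolAt_and_ordMinimalDiscriminant_of_smul_eq_baseChange _ _ R₀ hrel hR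
  exact ⟨hK, by rw [hO]; omega⟩

/-- **T31-N, `w = 1`: type `II*`, `v₃Δ_min = 12`, on the given model** (`b ≡ 1`, `3 ∥ b³ − A₃ = 3M₁`): `9 ∣ a₂ = −27b²`,
`81 ∣ a₄ = 648bM₁`, `3⁵ ∥ a₆ = −3888M₁²` ⇒ Steps 9–10 return `II*`, and the model is minimal BY THE EXIT
(`v₃Δ = 12`: neither `v₃Δ < 12` nor `v₃c₄ < 4`). [cite: SilvermanATAEC1994, IV.9.4 Steps 9–11] -/
theorem kodairaSymbolAt_and_ord_isoQ_zero_one (b A₃ : ℤ) (hA : A₃ % 3 = 1)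
    (hM : (3 : ℤ) ^ 1 ∣ b ^ 3 - A₃) (hM' : ¬ (3 : ℤ) ^ (1 + 1) ∣ b ^ 3 - A₃) :
    (isoQ b A₃ 0).kodairaSymbolAt (Additive.placeOf 3) = .IIstar ∧
      (isoQ b A₃ 0).ordMinimalDiscriminant (Additive.placeOf 3) = 12 := by
  have hA3 : ¬ (3 : ℤ) ∣ A₃ := by
    intro h; have := (Int.dvd_iff_emod_eq_zero ..).mp h; omega
  obtain ⟨M₁, hM₁⟩ := hM
  have hM₁u : ¬ (3 : ℤ) ∣ M₁ := fun ⟨k, hk⟩ ↦ hM' ⟨k, by rw [hM₁, hk, pow_succ]; ring⟩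
  rw [isoQ_eq_baseChange]
  rw [pow_one] at hM₁
  have hM0 : b ^ 3 - 3 ^ 0 * A₃ = 3 * M₁ := by rw [pow_zero, one_mul]; exact hM₁
  rw [hM0]
  set W₀ : WeierstrassCurve ℤ := isoModel b (3 * M₁) with hW₀
  have e1 : W₀.a₁ = 0 := rfl
  have e2 : W₀.a₂ = 3 ^ 2 * (-(3 * b ^ 2)) := by simp [hW₀, isoModel]; ring
  have e3 : W₀.a₃ = 0 := rfl
  have e4 : W₀.a₄ = 3 ^ 4 * (8 * b * M₁) := by simp [hW₀, isoModel]; ring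
  have e6 : W₀.a₆ = 3 ^ 5 * (-(16 * M₁ ^ 2)) := by simp [hW₀, isoModel]; ring
  have eΔ : W₀.Δ = 3 ^ 12 * (2 ^ 12 * (A₃ * M₁ ^ 3)) := by
    rw [hW₀, isoModel_Δ]
    have : b ^ 3 - 3 * M₁ = A₃ := by linear_combination hM₁
    rw [this]; ring
  have hΔ : (3 : ℤ) ^ 12 ∣ W₀.Δ := by rw [eΔ]; exact dvd_mul_right _ _
  have hΔ' : ¬ (3 : ℤ) ^ (12 + 1) ∣ W₀.Δ := by
    rw [eΔ]; exact not_pow_succ_dvd_pow_mul' _ (not_three_dvd_mul not_three_dvd_two_pow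
      (not_three_dvd_mul hA3 (not_three_dvd_pow hM₁u 3)))
  have h6' : ¬ (3 : ℤ) ^ (5 + 1) ∣ W₀.a₆ := by
    rw [e6]; refine not_pow_succ_dvd_pow_mul' 5 ?_
    rw [dvd_neg]; exact not_three_dvd_mul (by decide) (not_three_dvd_pow hM₁u 2)
  have hT : ∀ (v' : HeightOneSpectrum (𝓞 ℚ)) (ε : v'.adicCompletionIntegers ℚ), IsUnit ε →
      ((3 : ℕ) : v'.adicCompletionIntegers ℚ) = uniformizer (v'.adicCompletionIntegers ℚ) * ε →
      (W₀.map (Int.castRingHom (v'.adicCompletionIntegers ℚ))).kodairaSymbolOfMinimal = .IIstar := by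
    intro v' ε hε hpε
    haveI := perfectField_residueField_adicCompletionIntegers (K := ℚ) v'
    refine kodairaSymbolOfMinimal_intCast_eq_IIstar Nat.prime_three hε hpε ?_ ?_ ?_ ?_ ?_ ?_
    · rw [e1]; exact dvd_zero _
    · rw [e2]; exact natCast_pow_dvd_mul 2 _
    · rw [e3]; exact dvd_zero _
    · rw [e4]; exact natCast_pow_dvd_mul 4 _
    · rw [e6]; exact natCast_pow_dvd_mul 5 _
    · exact not_natCast_pow_dvd h6'
  exact FlexNormalForm.kodairaSymbolAt_and_ordMinimalDiscriminant_placeOf_three_of_intModel W₀ W₀ 1 rfl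
    (one_smul _ _).symm
    (fun v' hv' ↦ isMinimalAt_of_cast_kodairaSymbolOfMinimal_ne v' hv' W₀
      (fun ε hε hpε ↦ by rw [hT v' ε hε (by exact_mod_cast hpε)]; decide)) hΔ hΔ' hT

end Summit.BirchSwinnertonDyer.Rank1Residual.O5.FlexNormalForm.Isogenous
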